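import Literature.Geometry.Riemannian.ThreeShrinkerDegenerateDeveloping
import HarnessLib

/-!
# Degenerate three-dimensional shrinkers: the null direction under the exponential map

Continuation of `ThreeShrinkerDegenerateExpMap` (degenerate case of Munteanu–Wang 2016, Thm. 1.2).
The vector form of Cartan's formula: in the parallel frame `(e₀, e₁, e₂)` along `γ_v`
(`v = ρ u + s ν`, `(u, n, ν)` orthonormal, `ν` null, `S ≡ 1`) the Jacobi field with `J(0) = 0`,
`D_tJ(0) = ξ` is `J(t) = (⟨ξ,u⟩ t) e₀ + (⟨ξ,n⟩ j(t)) e₁ + (⟨ξ,ν⟩ t) e₂`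
(`jacobi_frame_expansion`). Consequently **`d(exp_p)_v(ν) = e₂(1)` is a unit null vector of
`Ric`** (`val_ricci_mfderiv_expMap_nu`, and in adapted coordinates
`val_ricci_mfderiv_expMap_nu_coords`): the null line field is developed onto itself — the input
for the second chart of the developing map and for the deck transformations
(`ThreeShrinkerDegenerateDevelopingGlue`).

Everything is proved; no new definitions (D-0026).

## References

* O. Munteanu, J. Wang, arXiv:1606.01861, Thm. 1.2 (p. 3). [MunteanuWang2016]
* I. Chavel, *Riemannian Geometry*, 2nd ed., CUP 2006, §II.5–II.6, Thm. II.6.3. [Chavel2006]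
* P. Petersen, W. Wylie, Geom. Topol. 14 (2010), §3. [PetersenWylie2010]
-/

noncomputable section

open Bundle Set Function Filter Module Metric
open scoped Manifold ContDiff Topology NNReal

namespace Literature.Geometry.Riemannian

open Lorentzian Lorentzian.PseudoRiemannianMetric
open Literature.Analysis.ODE.ShrinkerLeafProfile

variable {M : Type*} [TopologicalSpace M] [ChartedSpace (EuclideanSpace ℝ (Fin 3)) M]
  [IsManifold (𝓡 3) ∞ M]
  (g : PseudoRiemannianMetric (𝓡 3) ∞ (EuclideanSpace ℝ (Fin 3)) (TangentSpace (𝓡 3) : M → Type _))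
  [g.HasLeviCivita]

namespace DegenerateShrinker

section Along

variable [T2Space M] [ConnectedSpace M]
  -- `hg : g.IsRiemannian`, unfolded (positive definiteness on every tangent space)
  (hg : ∀ (x : M) (v : TangentSpace (𝓡 3) x), v ≠ 0 → 0 < g.val x v v)
  {f : M → ℝ} (hf : ContMDiff (𝓡 3) 𝓘(ℝ, ℝ) ∞ f) {lam : ℝ}
  (hsol : ∀ (x : M) (X Y : TangentSpace (𝓡 3) x),
    g.ricci x X Y + g.hessian f x X Y = lam * g.val x X Y)
  (hRic0 : ∀ (x : M) (w : TangentSpace (𝓡 3) x), 0 ≤ g.ricci x w w)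
  (hS : ∀ x, 0 < g.scalarCurvature x) {p₀ : M} {w₀ : TangentSpace (𝓡 3) p₀} (hw₀ : w₀ ≠ 0)
  (hnull : g.ricci p₀ w₀ w₀ = 0)
  {κ : (x : M) → TangentSpace (𝓡 3) x → ℝ}
  (hκ : ∀ (x : M) (w : TangentSpace (𝓡 3) x),
    κ x w = g.val x w w - 2 / g.scalarCurvature x * g.ricci x w w)
include hg hf hsol hRic0 hS hw₀ hnull

/-! ### The Jacobi field in the parallel frame -/

set_option maxHeartbeats 1600000 in
include hκ in
/-- **The Jacobi field in the parallel frame (vector form of Cartan's formula).** With the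
notation of `val_jacobi_sq`: at each `t ∈ (−2, 2)` there is an orthonormal frame `(e₀, e₁, e₂)` at
`γ_v(t)` (the parallel transport of `(u, n, ν)`) with `Ric(e₂, e₂) = 0` and
`J(t) = (⟨ξ,u⟩ t) e₀ + (⟨ξ,n⟩ j(t)) e₁ + (⟨ξ,ν⟩ t) e₂`.
[cite: Chavel2006, §II.5–II.6] [cite: MunteanuWang2016, Thm. 1.2] -/
theorem jacobi_frame_expansion (hS1 : ∀ x, g.scalarCurvature x = 1)
    (hc : IsGeodesicallyComplete g.leviCivita) {p : M} {u n ν : TangentSpace (𝓡 3) p}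
    (huu : g.val p u u = 1) (hnn : g.val p n n = 1) (hνν : g.val p ν ν = 1)
    (hun : g.val p u n = 0) (huν : g.val p u ν = 0) (hnν : g.val p n ν = 0)
    (hν : g.ricci p ν ν = 0) (ρ s : ℝ) {j j₁ : ℝ → ℝ} (hj : ∀ t, HasDerivAt j (j₁ t) t)
    (hj₁ : ∀ t, HasDerivAt j₁ (-(ρ ^ 2 / 2) * j t) t) (hj0 : j 0 = 0) (hj₁0 : j₁ 0 = 1)
    (ξ : TangentSpace (𝓡 3) p) {t : ℝ} (ht : t ∈ Ioo (-2 : ℝ) 2) :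
    ∃ e : Fin 3 → TangentSpace (𝓡 3) (maximalGeodesic g.leviCivita p (ρ • u + s • ν) t),
      (∀ i k, g.val (maximalGeodesic g.leviCivita p (ρ • u + s • ν) t) (e i) (e k) =
        if i = k then 1 else 0) ∧
      g.ricci (maximalGeodesic g.leviCivita p (ρ • u + s • ν) t) (e 2) (e 2) = 0 ∧
      velocity (𝓡 3) (fun s' : ℝ ↦ maximalGeodesic g.leviCivita p (ρ • u + s • ν + s' • ξ) t) 0 =
        (g.val p ξ u * t) • e 0 + (g.val p ξ n * j t) • e 1 + (g.val p ξ ν * t) • e 2 := by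
  haveI := contMDiffCovariantDerivative_leviCivita_one g
  haveI := contMDiffCovariantDerivative_leviCivita_infty g le_rfl
  have hLC := PseudoRiemannianMetric.isLeviCivita_leviCivita_holds (g := g)
  have hn2 : (2 : ℕ∞ω) ≤ ∞ := WithTop.coe_le_coe.2 le_top
  have hreg : g.leviCivita.IsLocallyContMDiff 1 := hLC.isLocallyContMDiff_one hn2
  have hg' : g.IsRiemannian := hg
  set v : TangentSpace (𝓡 3) p := ρ • u + s • ν with hvdef
  obtain ⟨-, hgeo, hγ0, hγv⟩ := maximalGeodesic_of_isGeodesicallyComplete hc p v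
  set γ : ℝ → M := maximalGeodesic g.leviCivita p v with hγdef
  have hb : γ 0 = p := hγ0
  have hsymm := g.symm p
  -- the Jacobi field
  obtain ⟨hJac, hJ0, hDJ0, hJd, hDJd⟩ := jacobiField_geodesicVariation g hreg hc p v ξ
  have hv0 : v + (0 : ℝ) • ξ = v := by rw [zero_smul, add_zero]
  rw [hv0] at hJac hJ0 hDJ0 hJd hDJd
  set J : Π t : ℝ, TangentSpace (𝓡 3) (γ t) := fun t ↦
    velocity (𝓡 3) (fun s' : ℝ ↦ maximalGeodesic g.leviCivita p (v + s' • ξ) t) 0 with hJdef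
  -- the parallel orthonormal frame `(E₀, E₁, E₂)` from `(u, n, ν)` on `(−2, 2)`
  have h0I : (0 : ℝ) ∈ Ioo (-2 : ℝ) 2 := ⟨by norm_num, by norm_num⟩
  set wfr : Fin 3 → TangentSpace (𝓡 3) (γ 0) := fun i ↦
    (![u, n, ν] : Fin 3 → EuclideanSpace ℝ (Fin 3)) i with hwfr
  have hw : ∀ i j, g.val (γ 0) (wfr i) (wfr j) = if i = j then 1 else 0 := by
    intro i j
    rw [hb]
    fin_cases i <;> fin_cases j
    · simpa [hwfr] using huu
    · simpa [hwfr] using hun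
    · simpa [hwfr] using huν
    · simpa [hwfr, hsymm u n] using hun
    · simpa [hwfr] using hnn
    · simpa [hwfr] using hnν
    · simpa [hwfr, hsymm u ν] using huν
    · simpa [hwfr, hsymm n ν] using hnν
    · simpa [hwfr] using hνν
  obtain ⟨Efr, hE0, hEpar, hEon⟩ :=
    exists_parallel_orthonormal_frame_maximalGeodesic g hg' hc p v h0I wfr hw
  have hE00 : Efr 0 0 = u := by rw [hE0]; rfl
  have hE10 : Efr 1 0 = n := by rw [hE0]; rfl
  have hE20 : Efr 2 0 = ν := by rw [hE0]; rfl
  -- `E₂` stays null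
  have hκν : κ p ν = 1 := by rw [hκ, hνν, hν, mul_zero, sub_zero]
  have hνnull : ∀ t ∈ Ioo (-2 : ℝ) 2, g.ricci (γ t) (Efr 2 t) (Efr 2 t) = 0 := by
    intro t ht
    have hk : κ (γ t) (Efr 2 t) = 1 := by
      rw [kappa_parallel_eq g hg hf hsol hRic0 hS hw₀ hnull hκ hgeo (hEpar 2) ht h0I]
      rw [hE20, hb]
      exact hκν
    have h22 : g.val (γ t) (Efr 2 t) (Efr 2 t) = 1 := by simpa using hEon t ht 2 2
    rw [ricci_eq_of_kappa g hS hκ, h22, hk, sub_self, mul_zero]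
  -- the velocity is `ρ E₀ + s E₂`
  have hQpar : IsParallelAlongOn g.leviCivita γ (fun t ↦ ρ • Efr 0 t - (-s) • Efr 2 t)
      (Ioo (-2 : ℝ) 2) :=
    isParallelAlongOn_sub (isParallelAlongOn_const_smul (hEpar 0) ρ)
      (isParallelAlongOn_const_smul (hEpar 2) (-s))
  have hvelpar : IsParallelAlongOn g.leviCivita γ (fun t ↦ velocity (𝓡 3) γ t) (Ioo (-2 : ℝ) 2) :=
    (IsGeodesicOn.isParallelAlongOn_velocity hgeo).mono (subset_univ _)
  have hvel : ∀ t ∈ Ioo (-2 : ℝ) 2, velocity (𝓡 3) γ t = ρ • Efr 0 t + s • Efr 2 t := by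
    intro t ht
    have h := eq_of_isParallelAlongOn g hg' hLC.2 (ordConnected_Ioo) hvelpar hQpar h0I
      (by
        rw [hE00, hE20, neg_smul, sub_neg_eq_add]
        exact hγv) ht
    rw [h, neg_smul, sub_neg_eq_add]
  -- the curvature matrix along `γ`
  have hR : ∀ t ∈ Ioo (-2 : ℝ) 2, ∀ i k : Fin 3,
      g.val (γ t) (g.leviCivita.curvature (γ t) (Efr k t) (velocity (𝓡 3) γ t)
        (velocity (𝓡 3) γ t)) (Efr i t) = if i = 1 ∧ k = 1 then ρ ^ 2 * (1 / 2) else 0 := by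
    intro t ht i k
    change g.val (γ t) (g.riemann (γ t) (Efr k t) (velocity (𝓡 3) γ t) (velocity (𝓡 3) γ t))
      (Efr i t) = _
    rw [hvel t ht, ← hS1 (γ t)]
    exact curvature_frame_general g hg hf hsol hRic0 hS hw₀ hnull (e := fun i ↦ Efr i t)
      (hEon t ht) (hνnull t ht) ρ s i k
  -- expansion of `J` in the frame and the component equations
  have hcard : Fintype.card (Fin 3) = finrank ℝ (EuclideanSpace ℝ (Fin 3)) := by simp
  have hexpJ : ∀ t ∈ Ioo (-2 : ℝ) 2, J t = ∑ i : Fin 3, g.val (γ t) (J t) (Efr i t) • Efr i t :=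
    fun t ht ↦ eq_sum_bilin_smul_of_orthonormal (g.val (γ t)) (hEon t ht) hcard (J t)
  have hJacI : IsJacobiFieldAlongOn g γ J (Ioo (-2 : ℝ) 2) := fun t _ ↦ hJac t (mem_univ t)
  have had : ∀ i, ∀ t ∈ Ioo (-2 : ℝ) 2, HasDerivAt (fun t ↦ g.val (γ t) (J t) (Efr i t))
      (g.val (γ t) (covariantDerivAlong g.leviCivita γ J t) (Efr i t)) t := fun i t ht ↦
    hasDerivAt_val_apply_of_isParallelAlongOn g hLC.2 (hJd t) (hEpar i) ht
  have hbd : ∀ i, ∀ t ∈ Ioo (-2 : ℝ) 2,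
      HasDerivAt (fun t ↦ g.val (γ t) (covariantDerivAlong g.leviCivita γ J t) (Efr i t))
        (-(if i = 1 then ρ ^ 2 / 2 else 0) * g.val (γ t) (J t) (Efr i t)) t := by
    intro i t ht
    have h := hasDerivAt_val_covariantDerivAlong_frame_of_expansion g hJacI (hDJd t)
      (e := Efr) hEpar ht (hexpJ t ht) i
    refine h.congr_deriv ?_
    rw [Fin.sum_univ_three, hR t ht i 0, hR t ht i 1, hR t ht i 2]
    fin_cases i <;> (simp; try ring)
  -- initial data
  have hJ0' : J 0 = 0 := hJ0
  have ha0 : ∀ i, g.val (γ 0) (J 0) (Efr i 0) = 0 := fun i ↦ by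
    rw [hJ0', map_zero, _root_.zero_apply]
  have hb0 : ∀ i, g.val (γ 0) (covariantDerivAlong g.leviCivita γ J 0) (Efr i 0) =
      g.val p ξ (wfr i) := fun i ↦ by
    rw [hDJ0, hE0, hb]
  -- solving: `a₀ = ⟨ξ,u⟩ t`, `a₂ = ⟨ξ,ν⟩ t`, `a₁ = ⟨ξ,n⟩ j(t)`
  have hlin : ∀ (c : ℝ), (∀ t', HasDerivAt (fun t : ℝ ↦ c * t) c t') ∧
      ∀ t', HasDerivAt (fun _ : ℝ ↦ c) (-(fun _ : ℝ ↦ (0 : ℝ)) t' * (c * t')) t' := fun c ↦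
    ⟨fun t' ↦ ((hasDerivAt_id' t').const_mul c).congr_deriv (mul_one c),
      fun t' ↦ (hasDerivAt_const t' c).congr_deriv (by simp)⟩
  have ha0t : g.val (γ t) (J t) (Efr 0 t) = g.val p ξ u * t :=
    eq_of_hasDerivAt_two_linear_Ioo (k := fun _ ↦ (0 : ℝ)) continuousOn_const
      (had 0) (fun t ht ↦ (hbd 0 t ht).congr_deriv (by simp)) (fun t _ ↦ (hlin (g.val p ξ u)).1 t)
      (fun t _ ↦ (hlin (g.val p ξ u)).2 t) (by rw [ha0 0, mul_zero])
      (by rw [hb0 0]; rfl) h0I ht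
  have ha2t : g.val (γ t) (J t) (Efr 2 t) = g.val p ξ ν * t :=
    eq_of_hasDerivAt_two_linear_Ioo (k := fun _ ↦ (0 : ℝ)) continuousOn_const
      (had 2) (fun t ht ↦ (hbd 2 t ht).congr_deriv (by simp)) (fun t _ ↦ (hlin (g.val p ξ ν)).1 t)
      (fun t _ ↦ (hlin (g.val p ξ ν)).2 t) (by rw [ha0 2, mul_zero])
      (by rw [hb0 2]; rfl) h0I ht
  have ha1t : g.val (γ t) (J t) (Efr 1 t) = g.val p ξ n * j t :=
    eq_of_hasDerivAt_two_linear_Ioo (k := fun _ ↦ ρ ^ 2 / 2) continuousOn_const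
      (had 1) (fun t ht ↦ (hbd 1 t ht).congr_deriv (by simp))
      (w := fun t ↦ g.val p ξ n * j t) (w₁ := fun t ↦ g.val p ξ n * j₁ t)
      (fun t _ ↦ (hj t).const_mul _) (fun t _ ↦ ((hj₁ t).const_mul _).congr_deriv (by ring))
      (by rw [ha0 1, hj0, mul_zero]) (by rw [hb0 1, hj₁0, mul_one]; rfl) h0I ht
  refine ⟨fun i ↦ Efr i t, hEon t ht, hνnull t ht, ?_⟩
  have h := hexpJ t ht
  rw [Fin.sum_univ_three, ha0t, ha1t, ha2t] at h
  exact h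

set_option maxHeartbeats 800000 in
include hκ in
/-- **`d(exp_p)_v(ν)` is a unit null vector** for `v = ρ u + s ν` (`(u,n,ν)` orthonormal, `ν` null,
`S ≡ 1`): it is the parallel transport `e₂(1)` of `ν` (`jacobi_frame_expansion` with `ξ = ν`).
[cite: MunteanuWang2016, Thm. 1.2] [cite: PetersenWylie2010, §3] -/
theorem val_ricci_mfderiv_expMap_nu (hS1 : ∀ x, g.scalarCurvature x = 1)
    (hc : IsGeodesicallyComplete g.leviCivita) {p : M} {u n ν : TangentSpace (𝓡 3) p}
    (huu : g.val p u u = 1) (hnn : g.val p n n = 1) (hνν : g.val p ν ν = 1)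
    (hun : g.val p u n = 0) (huν : g.val p u ν = 0) (hnν : g.val p n ν = 0)
    (hν : g.ricci p ν ν = 0) (ρ s : ℝ) {j j₁ : ℝ → ℝ} (hj : ∀ t, HasDerivAt j (j₁ t) t)
    (hj₁ : ∀ t, HasDerivAt j₁ (-(ρ ^ 2 / 2) * j t) t) (hj0 : j 0 = 0) (hj₁0 : j₁ 0 = 1) :
    g.val (expMap g.leviCivita p (ρ • u + s • ν))
      (mfderiv 𝓘(ℝ, EuclideanSpace ℝ (Fin 3)) (𝓡 3)
        (fun w : EuclideanSpace ℝ (Fin 3) ↦ expMap g.leviCivita p (show TangentSpace (𝓡 3) p from w))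
        (show EuclideanSpace ℝ (Fin 3) from ρ • u + s • ν) ν)
      (mfderiv 𝓘(ℝ, EuclideanSpace ℝ (Fin 3)) (𝓡 3)
        (fun w : EuclideanSpace ℝ (Fin 3) ↦ expMap g.leviCivita p (show TangentSpace (𝓡 3) p from w))
        (show EuclideanSpace ℝ (Fin 3) from ρ • u + s • ν) ν) = 1 ∧
    g.ricci (expMap g.leviCivita p (ρ • u + s • ν))
      (mfderiv 𝓘(ℝ, EuclideanSpace ℝ (Fin 3)) (𝓡 3)
        (fun w : EuclideanSpace ℝ (Fin 3) ↦ expMap g.leviCivita p (show TangentSpace (𝓡 3) p from w))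
        (show EuclideanSpace ℝ (Fin 3) from ρ • u + s • ν) ν)
      (mfderiv 𝓘(ℝ, EuclideanSpace ℝ (Fin 3)) (𝓡 3)
        (fun w : EuclideanSpace ℝ (Fin 3) ↦ expMap g.leviCivita p (show TangentSpace (𝓡 3) p from w))
        (show EuclideanSpace ℝ (Fin 3) from ρ • u + s • ν) ν) = 0 := by
  haveI := contMDiffCovariantDerivative_leviCivita_one g
  haveI := contMDiffCovariantDerivative_leviCivita_infty g le_rfl
  have h1I : (1 : ℝ) ∈ Ioo (-2 : ℝ) 2 := ⟨by norm_num, by norm_num⟩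
  obtain ⟨e, hon, hnull2, hJ⟩ := jacobi_frame_expansion g hg hf hsol hRic0 hS hw₀ hnull hκ hS1 hc huu
    hnn hνν hun huν hnν hν ρ s hj hj₁ hj0 hj₁0 ν h1I
  have hsymm := g.symm p
  rw [hsymm ν u, huν, hsymm ν n, hnν, hνν,
    velocity_geodesicVariation_eq_mfderiv_expMap hc p (ρ • u + s • ν) ν 1, one_smul, one_smul] at hJ
  simp only [zero_mul, zero_smul, zero_add, one_mul, one_smul] at hJ
  have hJ' : @Eq (EuclideanSpace ℝ (Fin 3)) (mfderiv 𝓘(ℝ, EuclideanSpace ℝ (Fin 3)) (𝓡 3)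
      (fun w : EuclideanSpace ℝ (Fin 3) ↦ expMap g.leviCivita p (show TangentSpace (𝓡 3) p from w))
      (show EuclideanSpace ℝ (Fin 3) from ρ • u + s • ν) ν) (e 2) := hJ
  have h22 : g.val (maximalGeodesic g.leviCivita p (ρ • u + s • ν) 1) (e 2) (e 2) = 1 := by
    simpa using hon 2 2
  suffices H : ∀ (y : M) (W : TangentSpace (𝓡 3) y),
      y = maximalGeodesic g.leviCivita p (ρ • u + s • ν) 1 →
      @Eq (EuclideanSpace ℝ (Fin 3)) W (e 2) → g.val y W W = 1 ∧ g.ricci y W W = 0 by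
    exact H _ _ (expMap_eq_maximalGeodesic hc p _) hJ'
  intro y W hy hW
  subst hy
  have hW' : W = e 2 := hW
  rw [hW']
  exact ⟨h22, hnull2⟩

end Along

end DegenerateShrinker

end Literature.Geometry.Riemannian

end
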